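import Summits.QuantumFields.QCD.Theorems.WilsonMobilityGapMobilityGapSketchFreeReduction

/-!
# Crux `MobilityGap` (stmt-QuantumFields-9150) — line `Sketch`: inertness of the universal stubs

Lead seat prover-line-stmt-QuantumFields-9150-c6-0 (cycle 7 of the line), helper file `--supports stmt-QuantumFields-9150`.

Skeleton v6 of line `Sketch` (`Cruxes/MobilityGap/Lines/Sketch.lean`) closes the crux from four stubs: the infrared stub
`stub_lightFree = LawLightFree` (`∀ N_f ∈ {2,3}, LightMomentFree N_f`), which is NECESSARY for the crux
(`lawLightFree_of_mobilityGap`, landed), and three UNIVERSAL laws (`stub_lowerAt = LawLowerFree`, `stub_windowAt`,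
`stub_deepWindowAt`), each of the shape `∀ d : LineData N_f, LightMomentAt N_f d.a d.β d.s → P d`.

This file records, kernel-checked, why the universal stubs are INERT as work items: the hypothesis of each of them,
instantiated at any single admissible datum, already proves the crux's necessary infrared core (§1), so that

* every universal law of this shape holds OR the core holds (§2, `universalLaw_or_core`): a REFUTATION of any universal
  stub is a PROOF of `LightMomentFree N_f` — the open infrared statement itself (`core_of_not_lawLowerFree`, and the
  fixed-flavour forms `core_two_of_not_universalLaw`, `core_three_of_not_universalLaw` covering the two sign stubs);
* conversely no universal stub can be discharged vacuously unless the crux is FALSE (§3, `not_mobilityGap_of_vacuous`):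
  emptiness of the light data for some `N_f ∈ {2,3}` refutes the crux.

Hence, short of settling the infrared core, a universal stub can be neither refuted nor vacuously proved; a genuine proof
must control the interacting phase-quenched Wilson measure along data nobody can exhibit.  Together with the necessity of
the core this is the formal content of the lead's L5 assessment (`Lines/Sketch.dead.md`).
-/

noncomputable section

namespace Summit.QuantumFields.QCD.Theorems.MobilityGapSketch

open scoped BigOperators Topology
open MeasureTheory Filter Set
open Literature.MathematicalPhysics.QuantumFieldTheory Literature.MathematicalPhysics.QuantumLattice
  Literature.Probability.LatticeModels

variable {Nf : ℕ}

/-! ### §1 Instantiating a universal stub's hypothesis proves the core -/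

/-- **Any admissible datum carrying a light moment IS a free light moment**: the hypothesis
`LightMomentAt N_f d.a d.β d.s` of every universal stub of skeleton v6, at any single `d : LineData N_f`, proves
`LightMomentFree N_f` (repack the fields of `d`). -/
theorem lightMomentFree_of_lightMomentAt (d : LineData Nf) (h : LightMomentAt Nf d.a d.β d.s) :
    LightMomentFree Nf :=
  ⟨d.a, d.β, d.a_pos, d.tendsto_a, d.scaling, d.s, d.s_pos, d.s_lt_one, h⟩

/-- The free light moment is exactly the existence of an admissible datum carrying a light moment at its own
exponent (`exists_lineData_of_lightMomentFree` and `lightMomentFree_of_lightMomentAt`). -/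
theorem lightMomentFree_iff_exists_lineData :
    LightMomentFree Nf ↔ ∃ d : LineData Nf, LightMomentAt Nf d.a d.β d.s :=
  ⟨exists_lineData_of_lightMomentFree, fun ⟨d, hd⟩ => lightMomentFree_of_lightMomentAt d hd⟩

/-! ### §2 Universal laws hold, or the core holds -/

/-- **Inertness dichotomy (fixed flavour number).** For every property `P` of admissible `N_f`-flavour data, either the
universal law `∀ d, LightMomentAt N_f d.a d.β d.s → P d` holds, or `LightMomentFree N_f` holds: if no admissible datum
carries a light moment the law is vacuous, and if one does it is a free light moment. -/
theorem universalLaw_or_core_at (P : LineData Nf → Prop) :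
    (∀ d : LineData Nf, LightMomentAt Nf d.a d.β d.s → P d) ∨ LightMomentFree Nf := by
  by_cases h : LightMomentFree Nf
  · exact Or.inr h
  · exact Or.inl fun d hd => absurd (lightMomentFree_of_lightMomentAt d hd) h

/-- **Inertness dichotomy (the line's flavour range).** For every family of properties `P N_f` of admissible data,
either the universal law `∀ N_f ∈ {2,3}, ∀ d, LightMomentAt … → P N_f d` holds, or the core `LightMomentFree N_f` holds
for some `N_f ∈ {2,3}`. -/
theorem universalLaw_or_core :
    ∀ P : (∀ Nf : ℕ, LineData Nf → Prop),
      (∀ Nf : ℕ, Nf = 2 ∨ Nf = 3 → ∀ d : LineData Nf, LightMomentAt Nf d.a d.β d.s → P Nf d) ∨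
        ∃ Nf : ℕ, (Nf = 2 ∨ Nf = 3) ∧ LightMomentFree Nf := by
  intro P
  by_cases h : ∃ Nf : ℕ, (Nf = 2 ∨ Nf = 3) ∧ LightMomentFree Nf
  · exact Or.inr h
  · refine Or.inl fun Nf hNf d hd => ?_
    exact absurd ⟨Nf, hNf, lightMomentFree_of_lightMomentAt d hd⟩ h

/-- **A refutation of the registered stub `stub_lowerAt` (`= LawLowerFree`) is a proof of the infrared core** for some
`N_f ∈ {2,3}`. -/
theorem core_of_not_lawLowerFree (h : ¬ LawLowerFree) : ∃ Nf : ℕ, (Nf = 2 ∨ Nf = 3) ∧ LightMomentFree Nf :=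
  (universalLaw_or_core fun _ d => LowerAt d).resolve_left h

/-- **A refutation of any universal two-flavour law** (in particular of the registered stub `stub_windowAt`, whose
statement is `∀ d : LineData 2, LightMomentAt 2 d.a d.β d.s → P d` for the window-count property `P`) **is a proof of
`LightMomentFree 2`.** -/
theorem core_two_of_not_universalLaw (P : LineData 2 → Prop)
    (h : ¬ ∀ d : LineData 2, LightMomentAt 2 d.a d.β d.s → P d) : LightMomentFree 2 :=
  (universalLaw_or_core_at P).resolve_left h

/-- **A refutation of any universal three-flavour law** (in particular of the registered stub `stub_deepWindowAt`) **is a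
proof of `LightMomentFree 3`.** -/
theorem core_three_of_not_universalLaw (P : LineData 3 → Prop)
    (h : ¬ ∀ d : LineData 3, LightMomentAt 3 d.a d.β d.s → P d) : LightMomentFree 3 :=
  (universalLaw_or_core_at P).resolve_left h

/-! ### §3 No vacuous discharge unless the crux is false -/

/-- **Vacuity of the light data refutes the crux.** If for some `N_f ∈ {2,3}` no admissible datum carries a light
moment (the only way a universal stub could be proved without controlling the interacting measure), then `MobilityGap`
is false — its own clauses (i)+(iii) at `m ≡ 1` produce such a datum (`lawLightFree_of_mobilityGap`). -/
theorem not_mobilityGap_of_vacuous (hNf : Nf = 2 ∨ Nf = 3)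
    (h : ∀ d : LineData Nf, ¬ LightMomentAt Nf d.a d.β d.s) :
    ¬ Summit.QuantumFields.QCD.Theses.WilsonMobilityGap.MobilityGap := fun hM => by
  obtain ⟨d, hd⟩ := exists_lineData_of_lightMomentFree (lawLightFree_of_mobilityGap hM Nf hNf)
  exact h d hd

/-- **Summary (the trichotomy of skeleton v6).** For every family of properties `P`: either the crux is false, or the
core holds for BOTH `N_f = 2` and `N_f = 3` (so every universal stub has an inhabited hypothesis and carries content about
the interacting measure), or — there is no third case.  Formally: `MobilityGap → (∀ N_f ∈ {2,3}, ∃ d, LightMomentAt …)`. -/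
theorem lightData_inhabited_of_mobilityGap (hM : Summit.QuantumFields.QCD.Theses.WilsonMobilityGap.MobilityGap) :
    ∀ Nf : ℕ, Nf = 2 ∨ Nf = 3 → ∃ d : LineData Nf, LightMomentAt Nf d.a d.β d.s :=
  fun Nf hNf => exists_lineData_of_lightMomentFree (lawLightFree_of_mobilityGap hM Nf hNf)

end Summit.QuantumFields.QCD.Theorems.MobilityGapSketch

end
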